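import Summits.PneNP.PneNP.Theorems.ChebyshevTracialDesignJuntaPatternLaw
import Literature.Computability.Complexity.KnapsackSosDegree
import HarnessLib

/-!
# Junta virtual positivity, part G: the virtual value of a containment event is a knapsack moment

Support file for the crux `TracialDecayExp20` (stmt-PneNP-19878) of route `ChebyshevTracialDesign`
(cell pnp-psdrank; step towards the LOW-DEGREE sector of the virtual-positivity step, p1 ROUND-3 §2.14–2.15:
"the virtual level is Grigoriev's knapsack functional"). For a perfect matching `M` of `S` (`N` edges), a
vertex set `A₀ ⊆ S` meeting `x` edges of `M`, and cut sizes `t = c + 2i`: the number of cuts `U ⊆ S` with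
`c` crossing and `i` internal edges and `A₀ ⊆ U` is `T(N; c, i) · P(c)` for an explicit real polynomial `P`
of degree `≤ x` whose value at the virtual level `c = 0` is EXACTLY Grigoriev's knapsack pseudo-moment
`knapsackMoment N (t/2) x = ∏_{j<x} (t/2 - j)/(N - j)` (`subset_event_poly`). Ingredients: the explicit
pattern polynomial of part B with its value at `0` (`pattern_poly_explicit`), and the observation that among
the traces `B ⊇ A₀` on the window only the full window has no crossing window edge. No definitions.
-/

set_option linter.dupNamespace false -- `Summit.PneNP.PneNP.…`: summit = sub-problem (D-0017)

namespace Summit.PneNP.PneNP.Theorems.ChebyshevTracialDesignJunta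

open Finset Literature.Barriers.PneNP Literature.Combinatorics.SimpleGraph.CycleSpace
open Polynomial Literature.Computability.Complexity

variable {V : Type*} [DecidableEq V]

/-- **Explicit pattern polynomial** `P = 2^{-y}[X]_y ∏_{j<z}((t-X)/2-j) ∏_{j<x-y-z}(N-(t+X)/2-j)/[N]_x`:
degree `≤ x`, value at `0` equal to `[y = 0]·∏_{j<z}(t/2-j)∏_{j<x-z}(N-t/2-j)/[N]_x`, and the level identity
`T(N-x; c-y, i-z) = T(N; c, i)·P(c)` for `c + 2i = t` (read as `0` when `y > c` or `z > i`). [folklore] -/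
theorem pattern_poly_explicit (N t : ℕ) {x y z : ℕ} (hx : x ≤ N) (hyz : y + z ≤ x) :
    (C (((2 : ℝ) ^ y * (N.descFactorial x : ℝ))⁻¹) * (∏ j ∈ range y, (X - C (j : ℝ))) *
        (∏ j ∈ range z, (C ((t : ℝ) / 2 - j) - C (1 / 2) * X)) *
        ∏ j ∈ range (x - y - z), (C ((N : ℝ) - (t : ℝ) / 2 - j) - C (1 / 2) * X)).natDegree ≤ x ∧
    (C (((2 : ℝ) ^ y * (N.descFactorial x : ℝ))⁻¹) * (∏ j ∈ range y, (X - C (j : ℝ))) *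
        (∏ j ∈ range z, (C ((t : ℝ) / 2 - j) - C (1 / 2) * X)) *
        ∏ j ∈ range (x - y - z), (C ((N : ℝ) - (t : ℝ) / 2 - j) - C (1 / 2) * X)).eval 0 =
      (if y = 0 then ((N.descFactorial x : ℝ))⁻¹ * (∏ j ∈ range z, ((t : ℝ) / 2 - j)) *
        ∏ j ∈ range (x - z), ((N : ℝ) - (t : ℝ) / 2 - j) else 0) ∧
    ∀ c i : ℕ, c + 2 * i = t →
      (((if y ≤ c ∧ z ≤ i then
          (N - x).choose (c - y + (i - z)) * (c - y + (i - z)).choose (i - z) * 2 ^ (c - y) else 0 : ℕ)) : ℝ) =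
        ((N.choose (c + i) * (c + i).choose i * 2 ^ c : ℕ) : ℝ) *
          (C (((2 : ℝ) ^ y * (N.descFactorial x : ℝ))⁻¹) * (∏ j ∈ range y, (X - C (j : ℝ))) *
            (∏ j ∈ range z, (C ((t : ℝ) / 2 - j) - C (1 / 2) * X)) *
            ∏ j ∈ range (x - y - z), (C ((N : ℝ) - (t : ℝ) / 2 - j) - C (1 / 2) * X)).eval (c : ℝ) := by
  set κ : ℝ := ((2 : ℝ) ^ y * (N.descFactorial x : ℝ))⁻¹ with hκ
  have hNx : 0 < (N.descFactorial x : ℝ) := by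
    have : N.descFactorial x ≠ 0 := fun h0 => by
      rw [Nat.descFactorial_eq_zero_iff_lt] at h0; omega
    positivity
  refine ⟨?_, ?_, ?_⟩
  · have h1 : (∏ j ∈ range y, (X - C (j : ℝ))).natDegree ≤ y := by
      refine (natDegree_prod_le _ _).trans ?_
      refine (sum_le_sum fun (j : ℕ) _ => (natDegree_X_sub_C ((j : ℕ) : ℝ)).le).trans ?_
      simp
    have hlin : ∀ a : ℝ, (C a - C (1 / 2 : ℝ) * X).natDegree ≤ 1 := fun a =>
      (natDegree_sub_le _ _).trans (max_le (by simp) ((natDegree_C_mul_le _ _).trans natDegree_X_le))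
    have h2 : (∏ j ∈ range z, (C ((t : ℝ) / 2 - j) - C (1 / 2) * X)).natDegree ≤ z := by
      refine (natDegree_prod_le _ _).trans ((sum_le_sum fun j _ => hlin _).trans ?_); simp
    have h3 : (∏ j ∈ range (x - y - z), (C ((N : ℝ) - (t : ℝ) / 2 - j) - C (1 / 2) * X)).natDegree ≤
        x - y - z := by
      refine (natDegree_prod_le _ _).trans ((sum_le_sum fun j _ => hlin _).trans ?_); simp
    refine (natDegree_mul_le.trans (add_le_add (natDegree_mul_le.trans (add_le_add
      ((natDegree_C_mul_le _ _).trans h1) h2)) h3)).trans ?_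
    omega
  · simp only [eval_mul, eval_C, eval_prod, eval_sub, eval_X, mul_zero, sub_zero]
    rcases Nat.eq_zero_or_pos y with hy0 | hy0
    · subst hy0
      simp only [range_zero, prod_empty, mul_one, Nat.sub_zero, if_true]
      rw [hκ, pow_zero, one_mul]
    · have : ∏ j ∈ range y, ((0 : ℝ) - (j : ℝ)) = 0 := prod_eq_zero (mem_range.2 hy0) (by simp)
      rw [this, if_neg (by omega)]
      simp
  · intro c i hci
    have evC : ∀ r : ℝ, ((∏ j ∈ range z, (C ((t : ℝ) / 2 - j) - C (1 / 2) * X)).eval r) =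
        ∏ j ∈ range z, (((t : ℝ) - r) / 2 - j) := fun r => by
      rw [eval_prod]; exact prod_congr rfl fun j _ => by simp; ring
    have evE : ∀ r : ℝ, ((∏ j ∈ range (x - y - z), (C ((N : ℝ) - (t : ℝ) / 2 - j) - C (1 / 2) * X)).eval r) =
        ∏ j ∈ range (x - y - z), ((N : ℝ) - ((t : ℝ) + r) / 2 - j) := fun r => by
      rw [eval_prod]; exact prod_congr rfl fun j _ => by simp; ring
    have evY : ∀ r : ℝ, ((∏ j ∈ range y, (X - C (j : ℝ))).eval r) = ∏ j ∈ range y, (r - j) := fun r => by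
      rw [eval_prod]; exact prod_congr rfl fun j _ => by simp
    rw [eval_mul, eval_mul, eval_mul, eval_C, evY, evC, evE]
    have hti : ((t : ℝ) - c) / 2 = i := by
      have : (t : ℝ) = c + 2 * i := by exact_mod_cast hci.symm
      rw [this]; ring
    have htc : ((t : ℝ) + c) / 2 = (c : ℝ) + i := by
      have : (t : ℝ) = c + 2 * i := by exact_mod_cast hci.symm
      rw [this]; ring
    rw [hti, htc]
    by_cases hyc : y ≤ c
    · by_cases hzi : z ≤ i
      · rw [if_pos ⟨hyc, hzi⟩]
        by_cases hciN : c + i ≤ N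
        · by_cases he : x - y - z ≤ N - c - i
          · have key := T_ratio_nat hx hyz hyc hzi hciN he
            have keyR : (((N - x).choose (c - y + (i - z)) * (c - y + (i - z)).choose (i - z) * 2 ^ (c - y) : ℕ) : ℝ) *
                ((2 : ℝ) ^ y * (N.descFactorial x : ℝ)) =
                ((N.choose (c + i) * (c + i).choose i * 2 ^ c : ℕ) : ℝ) *
                  ((c.descFactorial y : ℝ) * (i.descFactorial z : ℝ) * ((N - c - i).descFactorial (x - y - z) : ℝ)) := by
              exact_mod_cast key
            have h2y : (0 : ℝ) < (2 : ℝ) ^ y * (N.descFactorial x : ℝ) := by positivity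
            have keyR' := (eq_div_iff h2y.ne').2 keyR
            rw [keyR', cast_descFactorial_eq_prod hyc, cast_descFactorial_eq_prod hzi,
              cast_descFactorial_eq_prod he, hκ]
            have : ((N - c - i : ℕ) : ℝ) = (N : ℝ) - ((c : ℝ) + i) := by
              rw [Nat.sub_sub, Nat.cast_sub hciN, Nat.cast_add]
            rw [this]
            field_simp
          · have he' := not_le.1 he
            have hL : N - x < c - y + (i - z) := by omega
            rw [Nat.choose_eq_zero_of_lt hL]
            have hmem : N - c - i ∈ range (x - y - z) := mem_range.2 he'
            have h0 : ∏ j ∈ range (x - y - z), ((N : ℝ) - ((c : ℝ) + i) - j) = 0 := by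
              refine prod_eq_zero hmem ?_
              have : ((N - c - i : ℕ) : ℝ) = (N : ℝ) - ((c : ℝ) + i) := by
                rw [Nat.sub_sub, Nat.cast_sub hciN, Nat.cast_add]
              rw [← this]; ring
            rw [h0]; simp
        · have hciN' := not_le.1 hciN
          have hL : N - x < c - y + (i - z) := by omega
          rw [Nat.choose_eq_zero_of_lt hL, Nat.choose_eq_zero_of_lt hciN']
          simp
      · rw [if_neg (fun h => hzi h.2)]
        have h0 : ∏ j ∈ range z, ((i : ℝ) - j) = 0 := prod_eq_zero (mem_range.2 (not_le.1 hzi)) (by simp)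
        rw [h0]; simp
    · rw [if_neg (fun h => hyc h.1)]
      have h0 : ∏ j ∈ range y, ((c : ℝ) - j) = 0 := prod_eq_zero (mem_range.2 (not_le.1 hyc)) (by simp)
      rw [h0]; simp


/-- In a non-loop pair containing `a ∈ B` and `v ∉ B`, exactly one endpoint lies in `B`. [folklore] -/
theorem cutCount_eq_one_of_mem_of_not_mem {B : Finset V} {e : Sym2 V} {a v : V} (ha : a ∈ e) (hv : v ∈ e)
    (haB : a ∈ B) (hvB : v ∉ B) : cutCount B e = 1 := by
  have hav : a ≠ v := fun h => hvB (h ▸ haB)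
  induction e using Sym2.ind with
  | h p q =>
    rw [cutCount_mk]
    rcases Sym2.mem_iff.1 ha with rfl | rfl <;> rcases Sym2.mem_iff.1 hv with rfl | rfl
    · exact absurd rfl hav
    · simp [haB, hvB]
    · simp [haB, hvB]
    · exact absurd rfl hav

/-- **Containment events have knapsack-moment virtual value** (cell pnp-psdrank, ROUND-3 §2.14: "the virtual
level is Grigoriev's knapsack functional"): for a perfect matching `M` of `S` with `N` edges, `A₀ ⊆ S`
meeting `x` edges of `M`, and `t`, there is a real polynomial `P` of degree `≤ x` with
`P(0) = knapsackMoment N (t/2) x = ∏_{j<x}(t/2-j)/(N-j)` such that for all levels `c + 2i = t`,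
`#{U ⊆ S : c crossing, i internal, A₀ ⊆ U} = T(N; c, i)·P(c)`. [cite: Grigoriev2001, §1 (PDF p. 8)] -/
theorem subset_event_poly {S : Finset V} {M : Finset (Sym2 V)} (hM : IsPMOn S M) {A₀ : Finset V}
    (hA₀ : A₀ ⊆ S) (t : ℕ) :
    ∃ P : Polynomial ℝ, P.natDegree ≤ (M.filter fun e => ∃ a ∈ A₀, a ∈ e).card ∧
      P.eval 0 = knapsackMoment M.card ((t : ℝ) / 2) (M.filter fun e => ∃ a ∈ A₀, a ∈ e).card ∧
      ∀ c i : ℕ, c + 2 * i = t →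
        (((S.powerset.filter fun U => (M.filter fun e => cutCount U e = 1).card = c ∧
            (M.filter fun e => cutCount U e = 2).card = i ∧ A₀ ⊆ U).card : ℕ) : ℝ) =
          ((M.card.choose (c + i) * (c + i).choose i * 2 ^ c : ℕ) : ℝ) * P.eval (c : ℝ) := by
  classical
  set E := M.filter (fun e => ∃ a ∈ A₀, a ∈ e) with hE
  set W := S.filter (fun v => ∃ e ∈ E, v ∈ e) with hW
  have hEM : E ⊆ M := filter_subset _ _
  have hxN : E.card ≤ M.card := card_le_card hEM
  have hWE : IsPMOn W E := isPMOn_verts hM hEM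
  have hA₀W : A₀ ⊆ W := by
    intro a ha
    obtain ⟨e, he, hae⟩ := hM.exists_mem (hA₀ ha)
    exact mem_filter.2 ⟨hA₀ ha, e, mem_filter.2 ⟨he, a, ha, hae⟩, hae⟩
  -- abbreviations for the traces
  have hyz : ∀ B : Finset V, (E.filter fun e => cutCount B e = 1).card +
      (E.filter fun e => cutCount B e = 2).card ≤ E.card := by
    intro B
    rw [← card_union_of_disjoint (disjoint_filter.2 fun e _ h1 h2 => by omega)]
    exact card_le_card (union_subset (filter_subset _ _) (filter_subset _ _))
  -- the polynomial: sum of the explicit pattern polynomials over the traces containing `A₀`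
  refine ⟨∑ B ∈ W.powerset.filter (fun B => A₀ ⊆ B),
      C (((2 : ℝ) ^ (E.filter fun e => cutCount B e = 1).card * (M.card.descFactorial E.card : ℝ))⁻¹) *
        (∏ j ∈ range (E.filter fun e => cutCount B e = 1).card, (X - C (j : ℝ))) *
        (∏ j ∈ range (E.filter fun e => cutCount B e = 2).card, (C ((t : ℝ) / 2 - j) - C (1 / 2) * X)) *
        ∏ j ∈ range (E.card - (E.filter fun e => cutCount B e = 1).card - (E.filter fun e => cutCount B e = 2).card),
          (C ((M.card : ℝ) - (t : ℝ) / 2 - j) - C (1 / 2) * X), ?_, ?_, ?_⟩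
  · exact natDegree_sum_le_of_forall_le _ _ fun B _ => (pattern_poly_explicit M.card t hxN (hyz B)).1
  · -- value at the virtual level: only the full window `B = W` contributes
    rw [eval_finsetSum]
    have hWmem : W ∈ W.powerset.filter (fun B => A₀ ⊆ B) := mem_filter.2 ⟨mem_powerset.2 Subset.rfl, hA₀W⟩
    rw [sum_eq_single_of_mem W hWmem]
    · -- the term `B = W`: no crossing window edge, all `x` window edges internal
      have hin : ∀ e ∈ E, cutCount W e = 2 := fun e he => by
        induction e using Sym2.ind with
        | h p q =>
          have hpq := mem_sym2_iff.1 (hWE.1 he)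
          rw [cutCount_mk, if_pos (hpq p (Sym2.mem_mk_left p q)), if_pos (hpq q (Sym2.mem_mk_right p q))]
      have hy0 : (E.filter fun e => cutCount W e = 1).card = 0 := by
        rw [card_eq_zero, filter_eq_empty_iff]
        intro e he h1; rw [hin e he] at h1; exact absurd h1 (by decide)
      have hz : (E.filter fun e => cutCount W e = 2).card = E.card := by
        rw [filter_true_of_mem hin]
      rw [(pattern_poly_explicit M.card t hxN (hyz W)).2.1, if_pos hy0, hz, Nat.sub_self, range_zero,
        prod_empty, mul_one, knapsackMoment, prod_div_distrib, ← cast_descFactorial_eq_prod hxN]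
      exact (div_eq_inv_mul _ _).symm
    · intro B hB hBW
      obtain ⟨hBW', hA₀B⟩ := mem_filter.1 hB
      rw [mem_powerset] at hBW'
      rw [(pattern_poly_explicit M.card t hxN (hyz B)).2.1, if_neg]
      -- a vertex of `W` outside `B` lies on a window edge crossing `B`
      obtain ⟨v, hvW, hvB⟩ := exists_of_ssubset (lt_of_le_of_ne hBW' hBW)
      obtain ⟨-, e, he, hve⟩ := mem_filter.1 hvW
      obtain ⟨-, a, haA, hae⟩ := mem_filter.1 he
      have h1 : cutCount B e = 1 := cutCount_eq_one_of_mem_of_not_mem hae hve (hA₀B haA) hvB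
      have : e ∈ E.filter fun e => cutCount B e = 1 := mem_filter.2 ⟨he, h1⟩
      exact fun h0 => notMem_empty e (card_eq_zero.1 h0 ▸ this)
  · intro c i hci
    -- fibrewise over the trace on `W`
    have hfib : ((S.powerset.filter fun U => (M.filter fun e => cutCount U e = 1).card = c ∧
          (M.filter fun e => cutCount U e = 2).card = i ∧ A₀ ⊆ U).card : ℕ) =
        ∑ B ∈ W.powerset.filter (fun B => A₀ ⊆ B), (S.powerset.filter fun U =>
          (M.filter fun e => cutCount U e = 1).card = c ∧ (M.filter fun e => cutCount U e = 2).card = i ∧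
            U ∩ W = B).card := by
      rw [card_eq_sum_card_fiberwise (f := fun U => U ∩ W) (t := W.powerset.filter fun B => A₀ ⊆ B)]
      · refine sum_congr rfl fun B hB => ?_
        obtain ⟨-, hA₀B⟩ := mem_filter.1 hB
        rw [filter_filter]
        congr 1
        refine filter_congr fun U _ => ?_
        constructor
        · rintro ⟨⟨hc, hi, -⟩, hUW⟩; exact ⟨hc, hi, hUW⟩
        · rintro ⟨hc, hi, hUW⟩; exact ⟨⟨hc, hi, fun a ha => (mem_inter.1 (hUW.symm ▸ hA₀B ha)).1⟩, hUW⟩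
      · intro U hU
        obtain ⟨-, -, -, hA₀U⟩ := mem_filter.1 hU
        exact mem_filter.2 ⟨mem_powerset.2 inter_subset_right, fun a ha => mem_inter.2 ⟨hA₀U ha, hA₀W ha⟩⟩
    rw [hfib, Nat.cast_sum, eval_finsetSum, mul_sum]
    refine sum_congr rfl fun B hB => ?_
    obtain ⟨hBW, -⟩ := mem_filter.1 hB
    rw [card_fiber_eq hM hEM (mem_powerset.1 hBW) c i]
    exact (pattern_poly_explicit M.card t hxN (hyz B)).2.2 c i hci

end Summit.PneNP.PneNP.Theorems.ChebyshevTracialDesignJunta
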